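import Literature.Analysis.FluidPDE.Tao2016AveragedNS.SplitCascadeRescaledWindowCert
import HarnessLib

/-!
# The split Prop. 6.5: the window certificate shell by shell

T. Tao, *Finite time blowup for an averaged three-dimensional Navier–Stokes equation*,
arXiv:1402.0290v3, §5.5, §6.5.
HONEST FRAMING: statements about the SPLIT cascade model system; nothing here proves the split
Prop. 6.5 and nothing here concerns the true Navier–Stokes equations.

`SplitCascadeRescaledWindowCert.absW_le_windowLevel` bounds the three live shells `k ∈ {-1,0,1}` by
ONE level driven by the largest checkpoint value. For the reproduction of a shell-dependent profile
(`η(1) ≪ η(0) ≪ η(-1)`, needed because the window Grönwall factor exceeds `1` — see the seat report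
§7.6) one wants the bound shell by shell: `|Z̃_{i,k}(t)| ≤ windowLevel ε₀ K ε C₁ n₀ η_k` from
`|Z̃_{i,k}(0)| ≤ η_k` alone (the channel Grönwall lemmas are per shell; the other shells enter only
through the symmetric modes, bounded by `2` under `GoodAt`). Same proof.

## References

* T. Tao, arXiv:1402.0290v3, §5.5, §6.5. [`Tao2016AveragedNS`]
-/

noncomputable section

open Set MeasureTheory intervalIntegral Filter Topology Real

namespace Literature.Analysis.FluidPDE

namespace Tao2016AveragedNS

open TaoCascade

section CertShell

variable {γ ε₀ K ε C₁ C₂ C₃ : ℝ} {n₀ N : ℤ} {ηp : ℤ → ℝ} {βp : ℕ → ℝ} {τ : ℤ → ℝ}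
  {Y : Fin 4 → ℤ → ℝ → ℝ} {W : Fin 3 → ℤ → ℝ → ℝ} {F : ℤ → ℝ → ℝ} {T ζ : ℝ}

/-- **The window certificate, one live shell at a time** (the profile level `η_k` of shell `k` only): If `GoodAt` holds on
`[0, T]`, `T ≤ 100`, and the live asymmetries are at most `η` at the checkpoint `t = 0`
(`|Z̃_{i,k}(0)| ≤ η`, `k ∈ {-1,0,1}`), then `|Z̃_{i,k}(t)| ≤ windowLevel ε₀ K ε C₁ n₀ η` on `[0, T]` for
`k ∈ {-1,0,1}`. (Channel Grönwall at each live scale with the uniform levels: modes `≤ 2`, clock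
`≥ -2`, rates `Λ_k ≤ 6`, source `≤ 8C₁(1+ε₀)^{-n₀/2}`.) [cite: Tao2016AveragedNS, §5.5, §6.5] -/
theorem RescaledSplitHypotheses.absW_le_windowLevel_shell
    (h : RescaledSplitHypotheses γ ε₀ K ε C₁ C₂ C₃ n₀ N ηp βp τ Y W F) (hε₀ : 0 < ε₀) (hε₀1 : ε₀ < 1)
    (hε : 0 < ε) (hK : 1 ≤ K) (hC₁ : 0 ≤ C₁) (hτ0 : τ (n₀ - N) ≤ 0) {T ηm : ℝ}
    (hT : T ≤ 100) (hgood : ∀ t ∈ Icc 0 T, GoodAt ε₀ K Y F t)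
    {k : ℤ} (hk : k = -1 ∨ k = 0 ∨ k = 1) (hη : ∀ i : Fin 3, |W i k 0| ≤ ηm)
    {t : ℝ} (ht : t ∈ Icc 0 T) (i : Fin 3) :
    |W i k t| ≤ windowLevel ε₀ K ε C₁ n₀ ηm := by
  have h0 : (0 : ℝ) < 1 + ε₀ := by linarith
  have hK0 : 0 < K := by linarith
  have hT0 : 0 ≤ T := ht.1.trans ht.2
  set δ : ℝ := (1 + ε₀) ^ (-(n₀ : ℝ) / 2) with hδ
  have hδ0 : 0 < δ := Real.rpow_pos_of_pos h0 _
  set Λk : ℝ := (1 + ε₀) ^ ((5 : ℝ) * k / 2) with hΛk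
  have hΛk0 : 0 < Λk := Real.rpow_pos_of_pos h0 _
  have hk1 : (k : ℝ) ≤ 1 := by rcases hk with rfl | rfl | rfl <;> norm_num
  have hk1' : (-1 : ℝ) ≤ k := by rcases hk with rfl | rfl | rfl <;> norm_num
  have hΛk6 : Λk ≤ 6 := by
    calc Λk ≤ (1 + ε₀) ^ ((5 : ℝ) / 2) :=
          Real.rpow_le_rpow_of_exponent_le (by linarith) (by nlinarith)
      _ ≤ 6 := rpow_five_halves_le_six h0.le (by linarith)
  -- energies `≤ 2` and modes `≤ 2` on `[0, T]` at the live scales and at `k + 1`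
  have hkm : k = -1 ∨ k = 0 ∨ k = 1 ∨ k = 2 := by rcases hk with h1 | h1 | h1 <;> simp [h1]
  have hkm' : k + 1 = -1 ∨ k + 1 = 0 ∨ k + 1 = 1 ∨ k + 1 = 2 := by
    rcases hk with rfl | rfl | rfl <;> norm_num
  have hEk : ∀ s ∈ Icc 0 T, F k s ≤ 2 := fun s hs =>
    energy_le_two_of_goodAt h hε₀ hε₀1 hK (hτ0.trans hs.1) (hgood s hs) hkm
  have hEk1 : ∀ s ∈ Icc 0 T, F (k + 1) s ≤ 2 := fun s hs =>
    energy_le_two_of_goodAt h hε₀ hε₀1 hK (hτ0.trans hs.1) (hgood s hs) hkm'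
  have hY : ∀ s ∈ Icc 0 T, ∀ j : Fin 4, |Y j k s| ≤ 2 := fun s hs j =>
    h.abs_le_of_energy_le j k (hτ0.trans hs.1) (by norm_num) (by linarith [hEk s hs])
  have hY1 : ∀ s ∈ Icc 0 T, |Y 0 (k + 1) s| ≤ 2 := fun s hs =>
    h.abs_le_of_energy_le 0 (k + 1) (hτ0.trans hs.1) (by norm_num) (by linarith [hEk1 s hs])
  -- the source level `σ = 8 C₁ δ`
  have hsplit : (1 + ε₀) ^ ((2 : ℝ) * k - n₀ / 2) = (1 + ε₀) ^ ((2 : ℝ) * k) * δ := by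
    rw [hδ, ← Real.rpow_add h0]; congr 1; ring
  have hΛ2 : (1 + ε₀) ^ ((2 : ℝ) * k) ≤ 4 := by
    calc (1 + ε₀) ^ ((2 : ℝ) * k) ≤ (1 + ε₀) ^ (2 : ℝ) :=
          Real.rpow_le_rpow_of_exponent_le (by linarith) (by nlinarith)
      _ ≤ 2 ^ (2 : ℝ) := Real.rpow_le_rpow h0.le (by linarith) (by norm_num)
      _ = 4 := by norm_num
  have hσ : ∀ s ∈ Ico 0 T, C₁ * (1 + ε₀) ^ ((2 : ℝ) * k - n₀ / 2) * Real.sqrt (F k s) ≤ 8 * C₁ * δ := by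
    intro s hs
    have hsq : Real.sqrt (F k s) ≤ 2 := by
      have := hEk s (Ico_subset_Icc_self hs)
      calc Real.sqrt (F k s) ≤ Real.sqrt 4 := Real.sqrt_le_sqrt (by linarith)
        _ = 2 := by rw [show (4 : ℝ) = 2 ^ 2 by norm_num, Real.sqrt_sq (by norm_num)]
    rw [hsplit]
    have hq0 : 0 ≤ (1 + ε₀) ^ ((2 : ℝ) * k) := Real.rpow_nonneg h0.le _
    calc C₁ * ((1 + ε₀) ^ ((2 : ℝ) * k) * δ) * Real.sqrt (F k s)
        = C₁ * δ * ((1 + ε₀) ^ ((2 : ℝ) * k) * Real.sqrt (F k s)) := by ring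
      _ ≤ C₁ * δ * (4 * 2) := by
          apply mul_le_mul_of_nonneg_left _ (mul_nonneg hC₁ hδ0.le)
          exact mul_le_mul hΛ2 hsq (Real.sqrt_nonneg _) (by norm_num)
      _ = 8 * C₁ * δ := by ring
  -- the clock lower bound `b̃_k ≥ -2 = -(12/Λ_k)·(Λ_k/6)`; we use `β₀ = 12/Λ_k ≥ 2`
  have hb : ∀ s ∈ Ico 0 T, -(12 / Λk) ≤ Y 1 k s := by
    intro s hs
    have h1 := (abs_le.mp (hY s (Ico_subset_Icc_self hs) 1)).1
    have h2 : 2 ≤ 12 / Λk := by rw [le_div_iff₀ hΛk0]; linarith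
    linarith
  -- (A) the `c`-channel
  have hLc : ∀ s ∈ Icc 0 T, W 1 k s ^ 2 ≤ windowLevelC ε₀ K ε C₁ n₀ ηm := by
    intro s hs
    have hc := h.asymW_c_sq_le_gronwallBound (by linarith) hε (k := k) (t₁ := 0) (t₂ := T)
      (β₀ := 12 / Λk) (σ := 8 * C₁ * δ) (lam := 1) hτ0 one_pos hb hσ hs
    have hrate : 2 * ((1 + ε₀) ^ ((5 : ℝ) * k / 2) * (ε⁻¹ * K ^ 10)) * (12 / Λk) + 1 =
        24 * (ε⁻¹ * K ^ 10) + 1 := by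
      rw [← hΛk]; field_simp; ring
    rw [hrate, sub_zero, div_one] at hc
    refine hc.trans ?_
    unfold windowLevelC
    have hW0 : W 1 k 0 ^ 2 ≤ ηm ^ 2 := by
      have hw0 : |W 1 k 0| ≤ ηm := hη 1
      rw [← sq_abs]; exact pow_le_pow_left₀ (abs_nonneg _) hw0 2
    exact gronwallBound_mono (by positivity) hW0 (sq_nonneg _) le_rfl (sq_nonneg _) hs.1
      (hs.2.trans hT)
  have hLc0 : 0 ≤ windowLevelC ε₀ K ε C₁ n₀ ηm := (sq_nonneg _).trans (hLc 0 ⟨le_rfl, hT0⟩)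
  set ηc : ℝ := Real.sqrt (windowLevelC ε₀ K ε C₁ n₀ ηm) with hηc
  have hWc : ∀ s ∈ Icc 0 T, |W 1 k s| ≤ ηc := fun s hs => by
    rw [hηc, ← Real.sqrt_sq_eq_abs]; exact Real.sqrt_le_sqrt (hLc s hs)
  -- (P)+(H) the `(a,d)`-channel
  set M : ℝ := 12 * ε + 12 * ε ^ 2 + 72 * K with hM
  have hM0 : ∀ s ∈ Ico 0 T, (1 + ε₀) ^ ((5 : ℝ) * k / 2) *
      (ε * Y 1 k s + ε ^ 2 * Real.exp (-K ^ 10) * Y 2 k s) ≤ M := by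
    intro s hs
    have hb' := abs_le.mp (hY s (Ico_subset_Icc_self hs) 1)
    have hc' := abs_le.mp (hY s (Ico_subset_Icc_self hs) 2)
    have hE1 : Real.exp (-K ^ 10) ≤ 1 := Real.exp_le_one_iff.mpr (by
      have : 0 ≤ K ^ 10 := by positivity
      linarith)
    have hE0 : 0 < Real.exp (-K ^ 10) := Real.exp_pos _
    rw [← hΛk]
    have hin : ε * Y 1 k s + ε ^ 2 * Real.exp (-K ^ 10) * Y 2 k s ≤ 2 * ε + 2 * ε ^ 2 := by
      have a1 : ε * Y 1 k s ≤ ε * 2 := mul_le_mul_of_nonneg_left hb'.2 hε.le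
      have a2 : ε ^ 2 * Real.exp (-K ^ 10) * Y 2 k s ≤ ε ^ 2 * Real.exp (-K ^ 10) * 2 :=
        mul_le_mul_of_nonneg_left hc'.2 (by positivity)
      have a3 : ε ^ 2 * Real.exp (-K ^ 10) * 2 ≤ ε ^ 2 * 1 * 2 := by
        apply mul_le_mul_of_nonneg_right _ (by norm_num)
        exact mul_le_mul_of_nonneg_left hE1 (sq_nonneg _)
      linarith
    rcases le_or_gt 0 (ε * Y 1 k s + ε ^ 2 * Real.exp (-K ^ 10) * Y 2 k s) with hpos | hneg
    · calc Λk * (ε * Y 1 k s + ε ^ 2 * Real.exp (-K ^ 10) * Y 2 k s) ≤ 6 * (2 * ε + 2 * ε ^ 2) :=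
            mul_le_mul hΛk6 hin hpos (by norm_num)
        _ ≤ M := by rw [hM]; nlinarith [hK0]
    · have : Λk * (ε * Y 1 k s + ε ^ 2 * Real.exp (-K ^ 10) * Y 2 k s) ≤ 0 :=
        mul_nonpos_of_nonneg_of_nonpos hΛk0.le hneg.le
      have hMpos : 0 ≤ M := by rw [hM]; positivity
      linarith
  have hM2 : ∀ s ∈ Ico 0 T, (1 + ε₀) ^ ((5 : ℝ) * k / 2) *
      ((1 + ε₀) ^ ((5 : ℝ) / 2) * K * Y 0 (k + 1) s) ≤ M := by
    intro s hs
    have ha' := abs_le.mp (hY1 s (Ico_subset_Icc_self hs))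
    have hq6 : (1 + ε₀) ^ ((5 : ℝ) / 2) ≤ 6 := rpow_five_halves_le_six h0.le (by linarith)
    have hq0 : 0 ≤ (1 + ε₀) ^ ((5 : ℝ) / 2) := Real.rpow_nonneg h0.le _
    rw [← hΛk]
    rcases le_or_gt 0 (Y 0 (k + 1) s) with hpos | hneg
    · calc Λk * ((1 + ε₀) ^ ((5 : ℝ) / 2) * K * Y 0 (k + 1) s) ≤ 6 * (6 * K * 2) := by
            apply mul_le_mul hΛk6 _ (by positivity) (by norm_num)
            exact mul_le_mul (mul_le_mul_of_nonneg_right hq6 hK0.le) ha'.2 hpos (by positivity)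
        _ ≤ M := by rw [hM]; nlinarith [hε.le, sq_nonneg ε]
    · have : Λk * ((1 + ε₀) ^ ((5 : ℝ) / 2) * K * Y 0 (k + 1) s) ≤ 0 :=
        mul_nonpos_of_nonneg_of_nonpos hΛk0.le
          (mul_nonpos_of_nonneg_of_nonpos (by positivity) hneg.le)
      have hMpos : 0 ≤ M := by rw [hM]; positivity
      linarith
  have hRa : ∀ s ∈ Ico 0 T, |Y 0 k s| ≤ 2 := fun s hs => hY s (Ico_subset_Icc_self hs) 0
  have hRd : ∀ s ∈ Ico 0 T, |Y 3 k s| ≤ 2 := fun s hs => hY s (Ico_subset_Icc_self hs) 3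
  have hcI : ∀ s ∈ Ico 0 T, |W 1 k s| ≤ ηc := fun s hs => hWc s (Ico_subset_Icc_self hs)
  have hLad : W 0 k t ^ 2 + W 2 k t ^ 2 ≤ windowLevelAD ε₀ K ε C₁ n₀ ηm := by
    have had := h.asymW_ad_sq_le_gronwallBound (by linarith) hε (k := k) (t₁ := 0) (t₂ := T)
      (M := M) (R := 2) (ηc := ηc) (σ := 8 * C₁ * δ) (lam := 1) hτ0 one_pos (by norm_num)
      hM0 hM2 hRa hRd hcI hσ ht
    rw [sub_zero, div_one] at had
    refine had.trans ?_
    unfold windowLevelAD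
    have hW0 : W 0 k 0 ^ 2 + W 2 k 0 ^ 2 ≤ 2 * ηm ^ 2 := by
      have hw0 : |W 0 k 0| ≤ ηm ∧ |W 2 k 0| ≤ ηm := ⟨hη 0, hη 2⟩
      have a1 : W 0 k 0 ^ 2 ≤ ηm ^ 2 := by
        rw [← sq_abs]; exact pow_le_pow_left₀ (abs_nonneg _) hw0.1 2
      have a2 : W 2 k 0 ^ 2 ≤ ηm ^ 2 := by
        rw [← sq_abs]; exact pow_le_pow_left₀ (abs_nonneg _) hw0.2 2
      linarith
    have hηc0 : 0 ≤ ηc := Real.sqrt_nonneg _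
    have hG : (8 * C₁ * δ + (1 + ε₀) ^ ((5 : ℝ) * k / 2) * (ε ^ 2)⁻¹ * 2 * ηc) ^ 2 ≤
        (8 * C₁ * (1 + ε₀) ^ (-(n₀ : ℝ) / 2) + 12 * (ε ^ 2)⁻¹ *
          Real.sqrt (windowLevelC ε₀ K ε C₁ n₀ ηm)) ^ 2 := by
      rw [← hδ, ← hΛk, ← hηc]
      have hin : Λk * (ε ^ 2)⁻¹ * 2 * ηc ≤ 12 * (ε ^ 2)⁻¹ * ηc := by
        have : 0 ≤ (ε ^ 2)⁻¹ * ηc := by positivity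
        nlinarith
      have hl0 : 0 ≤ 8 * C₁ * δ + Λk * (ε ^ 2)⁻¹ * 2 * ηc := by positivity
      exact pow_le_pow_left₀ hl0 (by linarith) 2
    have hMK : 0 < 2 * M + 1 := by rw [hM]; positivity
    exact gronwallBound_mono hMK hW0 (by positivity)
      (by linarith [mul_le_mul_of_nonneg_left hG (by norm_num : (0 : ℝ) ≤ 2)]) (by positivity)
      ht.1 (ht.2.trans hT)
  -- conclusion
  have hLad0 : 0 ≤ windowLevelAD ε₀ K ε C₁ n₀ ηm := le_trans (by positivity) hLad
  unfold windowLevel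
  have hc_fin : |W 1 k t| ≤ Real.sqrt (windowLevelC ε₀ K ε C₁ n₀ ηm) := hWc t ht
  have ha_fin : |W 0 k t| ≤ Real.sqrt (windowLevelAD ε₀ K ε C₁ n₀ ηm) := by
    rw [← Real.sqrt_sq_eq_abs]; exact Real.sqrt_le_sqrt (by nlinarith [sq_nonneg (W 2 k t)])
  have hd_fin : |W 2 k t| ≤ Real.sqrt (windowLevelAD ε₀ K ε C₁ n₀ ηm) := by
    rw [← Real.sqrt_sq_eq_abs]; exact Real.sqrt_le_sqrt (by nlinarith [sq_nonneg (W 0 k t)])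
  have hs1 : 0 ≤ Real.sqrt (windowLevelC ε₀ K ε C₁ n₀ ηm) := Real.sqrt_nonneg _
  have hs2 : 0 ≤ Real.sqrt (windowLevelAD ε₀ K ε C₁ n₀ ηm) := Real.sqrt_nonneg _
  fin_cases i
  · simp only [Fin.zero_eta]; linarith
  · simp only [Fin.mk_one]; linarith
  · show |W 2 k t| ≤ _
    linarith


end CertShell

end Tao2016AveragedNS

end Literature.Analysis.FluidPDE
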